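import Literature.NumberTheory.Sieve.CircleMethod
import Literature.NumberTheory.Sieve.SingularSeries
import HarnessLib

/-!
# Major-arc facts for the prime exponential sum (Matomäki–Radziwiłł–Tao 2019)

Trunk AntSieve / family `parity`, topic `Literature/NumberTheory/Sieve`. Two named facts filed by
a grounder for route `Parity/MinorArcs` (items `stmt-Parity-0657…0662`), stated over the
sorry-free prelude `Literature.NumberTheory.Sieve.primeExpSum`, `Literature.NumberTheory.Sieve.majorArcs`, `Literature.NumberTheory.Sieve.goldbachSingularSeries`.

## Content

* `primeExpSumDyadic X α = S_{Λ1_{(X,2X]}}(α) = ∑_{X < n ≤ 2X} Λ(n) e(nα)`, written as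
  `primeExpSum (2X) α - primeExpSum X α`.
* `MatomakiRadziwillTao2019_prop41` — NAMED FACT (MRT 2019, Prop. 4.1): on a major arc
  `α = a/q + β`, `1 ≤ q ≤ log^B X`, `(a,q) = 1`, `|β| ≤ log^{B'} X / X`, one has
  `S_{Λ1_{[1,X]}}(α) = μ(q)/φ(q) ∫_1^X e(βx) dx + O_{A,B,B'}(X log^{-A} X)` for every `A > 0`
  (Siegel–Walfisz input; ineffective). Here `S_{Λ1_{[1,X]}} = Literature.primeExpSum X` verbatim.
* `MatomakiRadziwillTao2019_prop33i` — NAMED FACT (MRT 2019, Prop. 3.3(i), "major arcs for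
  the Hardy–Littlewood conjecture"): for `A > 0`, `0 < ε < 1/2`, `B ≥ 2A`, `B' ≥ 2B + A`,
  `0 < |h| ≤ X^{1-ε}`:
  `∫_{𝔐_{log^B X, X^{-1} log^{B'} X}} |S_{Λ1_{(X,2X]}}(α)|² e(αh) dα = 𝔖(h) X + O(d₂(h)^{O(1)} X log^{-A} X)`,
  with `𝔖(h)` the Goldbach/twin singular series of MRT eq. (7) (`= Literature.goldbachSingularSeries |h|`:
  `2Π₂ ∏_{p ∣ h, p > 2} (p-1)/(p-2)` for even `h`, `0` for odd `h`).
* `MatomakiRadziwillTao2019_theorem13i` — NAMED FACT (MRT 2019, Thm. 1.3(i), "averaged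
  Hardy–Littlewood conjecture", the paper's main theorem for prime pairs): for `A > 0`,
  `0 < ε < 1/2`, `X^{8/33+ε} ≤ H ≤ X^{1-ε}`, `0 ≤ h₀ ≤ X^{1-ε}`:
  `∑_{X < n ≤ 2X} Λ(n)Λ(n+h) = 𝔖(h) X + O_{A,ε}(X log^{-A} X)` for all but `O_{A,ε}(H log^{-A} X)`
  integers `h` with `|h − h₀| ≤ H` (the record exponent `σ = 8/33` of MRT §1, arXiv p. 5:
  "`1/5 < 11/48 < 25/108 < 7/30 < σ < 1/4`"; added 2026-08-30 for ledger item `wi-98521`, route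
  `Parity/HomothetyPencil`).

## Faithfulness notes

* Thm. 1.3(i) is recorded for `X : ℕ`, `2 ≤ X`, and INTEGER base points `h₀` (MRT: real `X ≥ 2`,
  `0 ≤ h₀ ≤ X^{1-ε}`) — a specialisation; the exceptional shifts form a finite set `E` of
  integers of size `≤ C'·H·log^{-A} X` depending on `X, H, h₀`; the implied constants `C, C'`
  depend on `A, ε` only (MRT's `O_{A,ε}`). At `h = 0` the tree's `goldbachSingularSeries 0 = 2Π₂`
  is not MRT's (divergent) `𝔖(0)`; this is harmless since one shift may always be put into `E`
  (`C'·H·log^{-A} X ≥ 1` after enlarging `C'`, as `H ≥ X^{8/33}`), so the recorded `Prop` is implied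
  by the printed theorem.

* MRT state both results for real `X ≥ 2`; they are recorded here for `X : ℕ`, `2 ≤ X`
  (a specialisation, since `S_{Λ1_{[1,X]}}` only sees `⌊X⌋`).
* MRT's major arcs `𝔐_{Q,δ} = ⋃_{q ≤ Q} ⋃_{(a,q)=1} [a/q - δ, a/q + δ] ⊆ 𝕋 = ℝ/ℤ` (p. 18) are, after
  identifying `𝕋` with `[0,1]` (endpoints null), exactly `Literature.majorArcs X P Q` with `P/X = δ`, i.e.
  `P = log^{B'} X`, `Q = log^B X` (both centres `0/1` and `1/1` are included in `Literature.NumberTheory.Sieve.majorArcs`,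
  covering the wrapped arc around `0`).
* The route items use `P = Q = (log N)^B` and `S` over `[1,N]`; that is NOT an instance of
  Prop. 3.3(i) (`B' ≥ 2B + A > B` there, and the dyadic sum) — the classical `P = Q` evaluation
  (Vaughan 1997, §3.1–3.2) follows from Prop. 4.1 by routine integration but is not vendored here.

## Sources

* K. Matomäki, M. Radziwiłł, T. Tao, *Correlations of the von Mangoldt and higher divisor
  functions I. Long shift ranges*, Proc. LMS 118 (2019) 284–350, arXiv:1707.01315. Page locators
  below are those of the held arXiv text (`lit read arxiv:1707.01315`, 40 pp.; reground 2026-08-14,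
  statements re-read verbatim against the two fact bodies): p. 18 (definition of `𝔐_{Q,δ}`:
  "`𝔐_{Q,δ} ≔ ⋃_{1 ≤ q ≤ Q} ⋃_{a:(a,q)=1} [a/q − δ, a/q + δ]` … We will take `Q ≔ log^B X` and
  `δ ≔ X^{-1} log^{B'} X`"), p. 18 Prop. 3.3(i), p. 20 Prop. 4.1 ("Proof. See [nathanson]. We remark
  that this estimate requires Siegel's theorem and so the bounds are ineffective."), p. 3 eq. (7)
  (`𝔖(h) ≔ 2Π₂ ∏_{p ∣ h, p>2} (p-1)/(p-2)` for even `h`, vanishing for odd `h`). (An earlier pass quoted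
  pp. 34/35/37/2 from a differently paginated copy; theorem numbers are unchanged.)
* M. B. Nathanson, *Additive Number Theory: The Classical Bases*, GTM 164 (1996) — the `[nathanson]`
  of Prop. 4.1: §8.3 pp. 134–135 (major arcs `|α − a/q| ≤ Q/N`, `Q = (log N)^B`, `0 ≤ a ≤ q`,
  `𝔪 = [0,1] ∖ 𝔐` — literally `Literature.majorArcs N Q Q` / `Literature.minorArcs N Q Q`), Lemma 8.3 p. 136
  (`F(α) = μ(q)/φ(q) u(β) + O(Q²N/(log N)^C)` on `𝔐(q,a)`, `C > 2B`). [cite: Nathanson1996, Lemma 8.3]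
* R. C. Vaughan, *The Hardy–Littlewood Method*, 2nd ed. (1997), Lemma 3.1 and §3.2.
-/

noncomputable section

open scoped FourierTransform ArithmeticFunction ArithmeticFunction.Moebius

open MeasureTheory ArithmeticFunction

namespace Literature.NumberTheory.Sieve

/-- The dyadic prime exponential sum `S_{Λ1_{(X,2X]}}(α) = ∑_{X < n ≤ 2X} Λ(n) e(nα)`
(Matomäki–Radziwiłł–Tao 2019, §3, notation `S_f(α) = ∑_n f(n) e(nα)` with `f = Λ1_{(X,2X]}`),
expressed through `Literature.NumberTheory.Sieve.primeExpSum`. [cite: MatomakiRadziwillTao2019, §3, p. 17 (arXiv)] -/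
def primeExpSumDyadic (X : ℕ) (α : ℝ) : ℂ :=
  primeExpSum (2 * X) α - primeExpSum X α

/-- NAMED FACT — **prime exponential sum on a major arc** (Matomäki–Radziwiłł–Tao 2019,
Prop. 4.1: "Let `A, B, B' > 0`, `X ≥ 2`, and let `α = a/q + β` for some `1 ≤ q ≤ log^B X`,
`(a, q) = 1`, and `|β| ≤ log^{B'} X / X`. Then
`S_{Λ1_{[1,X]}}(α) = (μ(q)/φ(q)) ∫_1^X e(βx) dx + O_{A,B,B'}(X log^{-A} X)`"; proof: "[66, Lemma 8.3]",
via Siegel–Walfisz, ineffective). Recorded for `X : ℕ`, where `S_{Λ1_{[1,X]}} = primeExpSum X`.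
Users take `(h : MatomakiRadziwillTao2019_prop41)`. [cite: MatomakiRadziwillTao2019, Prop. 4.1, p. 20 (arXiv)] -/
def MatomakiRadziwillTao2019_prop41 : Prop :=
  ∀ A B B' : ℝ, 0 < A → 0 < B → 0 < B' →
    ∃ C : ℝ, ∀ X : ℕ, 2 ≤ X →
      ∀ q : ℕ, 1 ≤ q → (q : ℝ) ≤ Real.log X ^ B →
      ∀ a : ℤ, Int.gcd a q = 1 →
      ∀ β : ℝ, |β| ≤ Real.log X ^ B' / X →
        ‖primeExpSum X (a / q + β)
            - ((μ q : ℝ) / (Nat.totient q : ℝ) : ℂ) * ∫ x in (1 : ℝ)..X, (𝐞 (β * x) : ℂ)‖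
          ≤ C * X * Real.log X ^ (-A)

/-- NAMED FACT — **major arcs for the Hardy–Littlewood (prime pair) conjecture**
(Matomäki–Radziwiłł–Tao 2019, Prop. 3.3(i): "Let `A > 0`, `0 < ε < 1/2` … `X ≥ 2`, `B ≥ 2A` and
`B' ≥ 2B + A`. Let `h` be an integer with `0 < |h| ≤ X^{1-ε}`. …
`∫_{𝔐_{log^B X, X^{-1} log^{B'} X}} |S_{Λ1_{(X,2X]}}(α)|² e(αh) dα = 𝔖(h) X + O_{ε,A,B,B'}(d₂(h)^{O(1)} X log^{-A} X)`").
Here `𝔐_{Q,δ} ⊆ 𝕋 ≅ [0,1]` is `Literature.majorArcs X (log^{B'} X) (log^B X)` (half-width `P/X = δ`),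
`𝔖(h)` (MRT eq. (7)) is `Literature.goldbachSingularSeries |h|`, `d₂` is the divisor function, and the
printed `O(1)` exponent is an existential constant `c`. Recorded for `X : ℕ`.
Users take `(h : MatomakiRadziwillTao2019_prop33i)`. [cite: MatomakiRadziwillTao2019, Prop. 3.3(i), p. 18 (arXiv)] -/
def MatomakiRadziwillTao2019_prop33i : Prop :=
  ∀ A ε B B' : ℝ, 0 < A → 0 < ε → ε < 1 / 2 → 2 * A ≤ B → 2 * B + A ≤ B' →
    ∃ C c : ℝ, ∀ X : ℕ, 2 ≤ X →
      ∀ h : ℤ, h ≠ 0 → (|h| : ℝ) ≤ (X : ℝ) ^ (1 - ε) →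
        ‖(∫ α in majorArcs X (Real.log X ^ B') (Real.log X ^ B),
              ((‖primeExpSumDyadic X α‖ ^ 2 : ℝ) : ℂ) * (𝐞 (α * h) : ℂ))
            - (goldbachSingularSeries h.natAbs * X : ℂ)‖
          ≤ C * ((Nat.divisors h.natAbs).card : ℝ) ^ c * X * Real.log X ^ (-A)

/-! ### The main theorem for prime pairs -/

/-- The **shifted prime-pair correlation** `∑_{X < n ≤ 2X} Λ(n) Λ(n + h)` of Matomäki–Radziwiłł–Tao
2019, §1 (for an integer shift `h`; the argument `n + h` is read in `ℕ` through `Int.toNat`, which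
only matters when `n + h ≤ 0`, where `Λ = 0` anyway). [cite: MatomakiRadziwillTao2019, §1, statement 1.1 (i) of the paper, p. 3 (arXiv)] -/
def vonMangoldtPairCorrelation (X : ℕ) (h : ℤ) : ℝ :=
  ∑ n ∈ Finset.Ioc X (2 * X), (Λ n : ℝ) * Λ ((n : ℤ) + h).toNat

/-- NAMED FACT — **the Hardy–Littlewood prime-pair asymptotic on average over shifts, range `H ≥ X^{8/33+ε}`**
(Matomäki–Radziwiłł–Tao 2019, Theorem 1.3: "Let `A > 0`, `0 < ε < 1/2` and `k, l ≥ 2` be fixed,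
and suppose that `X^{σ+ε} ≤ H ≤ X^{1−ε}` for some `X ≥ 2`, where `σ` is defined by (sigmadef)
[`σ = 8/33`; "`7/30 < σ < 1/4`"]. Let `0 ≤ h₀ ≤ X^{1−ε}`. (i) (Averaged Hardy-Littlewood [asymptotic])
One has `∑_{X < n ≤ 2X} Λ(n)Λ(n+h) = 𝔖(h) X + O_{A,ε}(X log^{−A} X)` for all but
`O_{A,ε}(H log^{−A} X)` values of `h` with `|h − h₀| ≤ H`."). Here `𝔖(h)` (MRT eq. (7)) is
`Literature.goldbachSingularSeries |h|` (`0` for odd `h`), the exceptional shifts are a finite set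
`E` of integers with `|E| ≤ C'·H·log^{−A} X`, and `C, C'` depend on `A, ε` only. Recorded for
`X : ℕ` and integer `h₀` (module docstring, "Faithfulness notes", incl. the shift `h = 0`).
Users take `(h : MatomakiRadziwillTao2019_theorem13i)`.
[cite: MatomakiRadziwillTao2019, Thm. 1.3(i), p. 6 (arXiv)] -/
def MatomakiRadziwillTao2019_theorem13i : Prop :=
  ∀ A ε : ℝ, 0 < A → 0 < ε → ε < 1 / 2 →
    ∃ C C' : ℝ, ∀ (X : ℕ) (H : ℝ), 2 ≤ X →
      (X : ℝ) ^ (8 / 33 + ε) ≤ H → H ≤ (X : ℝ) ^ (1 - ε) →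
      ∀ h₀ : ℤ, 0 ≤ h₀ → (h₀ : ℝ) ≤ (X : ℝ) ^ (1 - ε) →
        ∃ E : Finset ℤ, (E.card : ℝ) ≤ C' * H * Real.log X ^ (-A) ∧
          ∀ h : ℤ, |((h - h₀ : ℤ) : ℝ)| ≤ H → h ∉ E →
            |vonMangoldtPairCorrelation X h - goldbachSingularSeries h.natAbs * X|
              ≤ C * X * Real.log X ^ (-A)

end Literature.NumberTheory.Sieve

end
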